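import Summits.Ventures.CertifiedArithmetic.LowPrec.OptTreePoly

/-!
HONEST FRAMING: certified error envelopes and provably optimal rounding/accumulation schemes for
low-precision formats under stated cost models; every table by two implementations; no hardware
or vendor claims.

# Theorem P: pairwise summation minimises the tree polynomial (opt, generation 4)

With `B_n(u)` defined by the pairwise recursion `B_0 = 0, B_1 = 1, B_n = B_⌈n/2⌉ + u·B_⌊n/2⌋`
(equivalently `Σ_{j<n} u^{popcount j}`, equivalently `Σ_i u^{i-1}(1+u)^{H_i}` over the binary
expansion `n = Σ_i 2^{H_i}`), every summation tree with `n` leaves has `B_n(u) ≤ M_t(u)` for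
`0 ≤ u ≤ 1` (**Lemma B** `optB_add_le`: `B_{a+b} ≤ B_a + u·B_b` for `b ≤ a`, by a four-parity
induction), with equality for the pairwise (halving) tree `pw n`.  Combined with Theorem U
(`OptTreePoly.lean`): among all summation trees on `n` nonnegative floating-point summands the
pairwise tree has the smallest tree-polynomial constant `1 - 1/B_n(u)`.  New result of the cell.
-/

namespace Summit.Ventures.CertifiedArithmetic.LowPrec.Opt

open Literature.ComputerArithmetic.JeannerodRump2018
open Literature.ComputerArithmetic.JeannerodRump2018.SumTree

/-! ## Theorem P: the minimum of the tree polynomial over all trees with `n` leaves -/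

/-- `B_n(u)`: `B_0 = 0`, `B_1 = 1`, `B_n = B_⌈n/2⌉ + u·B_⌊n/2⌋` (`= Σ_{j<n} u^{popcount j}`). -/
def optB (u : ℚ) : ℕ → ℚ
  | 0 => 0
  | 1 => 1
  | n + 2 => optB u ((n + 3) / 2) + u * optB u ((n + 2) / 2)
decreasing_by all_goals simp_wf; all_goals omega

/-- `B_0 = 0`. -/
@[simp] theorem optB_zero (u : ℚ) : optB u 0 = 0 := by simp [optB]
/-- `B_1 = 1`. -/
@[simp] theorem optB_one (u : ℚ) : optB u 1 = 1 := by simp [optB]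

/-- Defining recursion of `B_{n+2}`. -/
theorem optB_add_two (u : ℚ) (n : ℕ) :
    optB u (n + 2) = optB u ((n + 3) / 2) + u * optB u ((n + 2) / 2) := by
  rw [optB]

/-- `B_{2m} = (1+u)·B_m`. -/
theorem optB_two_mul (u : ℚ) (m : ℕ) : optB u (2 * m) = (1 + u) * optB u m := by
  rcases m with _ | m
  · simp
  · rw [show 2 * (m + 1) = 2 * m + 2 by ring, optB_add_two,
      show (2 * m + 3) / 2 = m + 1 by omega, show (2 * m + 2) / 2 = m + 1 by omega]
    ring

/-- `B_{2m+1} = B_{m+1} + u·B_m`. -/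
theorem optB_two_mul_add_one (u : ℚ) (m : ℕ) :
    optB u (2 * m + 1) = optB u (m + 1) + u * optB u m := by
  rcases m with _ | m
  · simp
  · rw [show 2 * (m + 1) + 1 = (2 * m + 1) + 2 by ring, optB_add_two,
      show (2 * m + 1 + 3) / 2 = m + 2 by omega, show (2 * m + 1 + 2) / 2 = m + 1 by omega]

/-- `0 ≤ B_n` for `u ≥ 0`. -/
theorem optB_nonneg {u : ℚ} (hu : 0 ≤ u) : ∀ n, 0 ≤ optB u n := by
  intro n
  induction n using Nat.strong_induction_on with
  | _ n ih =>
    rcases n with _ | _ | n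
    · simp
    · simp
    · rw [optB_add_two]
      have h1 := ih ((n + 3) / 2) (by omega)
      have h2 := ih ((n + 2) / 2) (by omega)
      nlinarith [mul_nonneg hu h2]

/-- `B_n ≤ B_{n+1}` for `u ≥ 0` (the increment is `u^{popcount n}`). -/
theorem optB_le_succ {u : ℚ} (hu : 0 ≤ u) : ∀ n, optB u n ≤ optB u (n + 1) := by
  intro n
  induction n using Nat.strong_induction_on with
  | _ n ih =>
    rcases Nat.even_or_odd' n with ⟨m, hm | hm⟩
    · -- n = 2m
      subst hm
      rcases m with _ | m
      · simp
      · rw [optB_two_mul_add_one, optB_two_mul]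
        have := ih (m + 1) (by omega)
        nlinarith
    · -- n = 2m+1
      subst hm
      rw [optB_two_mul_add_one, show 2 * m + 1 + 1 = 2 * (m + 1) by ring, optB_two_mul]
      have := ih m (by omega)
      nlinarith [mul_le_mul_of_nonneg_left this hu]

/-- `B` is monotone in `n` for `u ≥ 0`. -/
theorem optB_mono {u : ℚ} (hu : 0 ≤ u) {m n : ℕ} (h : m ≤ n) : optB u m ≤ optB u n := by
  have key : ∀ k : ℕ, optB u m ≤ optB u (m + k) := by
    intro k
    induction k with
    | zero => simp
    | succ k ih => exact le_trans ih (by rw [← Nat.add_assoc]; exact optB_le_succ hu _)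
  obtain ⟨k, rfl⟩ := Nat.exists_eq_add_of_le h
  exact key k

/-- **Lemma B.**  `B_{a+b} ≤ B_a + u·B_b` for `b ≤ a` and `0 ≤ u ≤ 1`. -/
theorem optB_add_le {u : ℚ} (hu0 : 0 ≤ u) (hu1 : u ≤ 1) :
    ∀ N a b : ℕ, a + b ≤ N → b ≤ a → optB u (a + b) ≤ optB u a + u * optB u b := by
  intro N
  induction N with
  | zero =>
      intro a b hN hba
      have ha : a = 0 := by omega
      have hb : b = 0 := by omega
      subst ha; subst hb; simp
  | succ N ih =>
      intro a b hN hba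
      rcases Nat.eq_zero_or_pos b with hb | hb
      · subst hb; simp
      rcases Nat.even_or_odd' a with ⟨α, hα | hα⟩ <;> rcases Nat.even_or_odd' b with ⟨β, hβ | hβ⟩
      · -- a = 2α, b = 2β
        subst hα; subst hβ
        rw [show 2 * α + 2 * β = 2 * (α + β) by ring, optB_two_mul, optB_two_mul, optB_two_mul]
        have h := ih α β (by omega) (by omega)
        have h1u : 0 ≤ 1 + u := by linarith
        nlinarith [mul_le_mul_of_nonneg_left h h1u]
      · -- a = 2α, b = 2β+1 (so β + 1 ≤ α)
        subst hα; subst hβ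
        rw [show 2 * α + (2 * β + 1) = 2 * (α + β) + 1 by ring, optB_two_mul_add_one,
          optB_two_mul, optB_two_mul_add_one]
        have h1 := ih α (β + 1) (by omega) (by omega)
        have h2 := ih α β (by omega) (by omega)
        rw [show α + β + 1 = α + (β + 1) by ring]
        nlinarith [mul_le_mul_of_nonneg_left h2 hu0]
      · -- a = 2α+1, b = 2β (β ≤ α)
        subst hα; subst hβ
        rw [show 2 * α + 1 + 2 * β = 2 * (α + β) + 1 by ring, optB_two_mul_add_one,
          optB_two_mul, optB_two_mul_add_one]
        have h1 := ih (α + 1) β (by omega) (by omega)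
        have h2 := ih α β (by omega) (by omega)
        rw [show α + β + 1 = α + 1 + β by ring]
        nlinarith [mul_le_mul_of_nonneg_left h2 hu0]
      · -- a = 2α+1, b = 2β+1 (β ≤ α)
        subst hα; subst hβ
        rcases Nat.eq_or_lt_of_le (show β ≤ α by omega) with heq | hlt
        · -- a = b: B(2a) = (1+u) B(a)
          subst heq
          rw [show 2 * β + 1 + (2 * β + 1) = 2 * (2 * β + 1) by ring, optB_two_mul]
          ring_nf; exact le_rfl
        · rw [show 2 * α + 1 + (2 * β + 1) = 2 * (α + β + 1) by ring, optB_two_mul,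
            optB_two_mul_add_one, optB_two_mul_add_one]
          have h1 := ih (α + 1) β (by omega) (by omega)
          have h2 := ih α (β + 1) (by omega) (by omega)
          rw [show α + 1 + β = α + β + 1 by ring] at h1
          rw [show α + (β + 1) = α + β + 1 by ring] at h2
          have hm := optB_le_succ hu0 β
          have hprod : 0 ≤ u * (1 - u) * (optB u (β + 1) - optB u β) :=
            mul_nonneg (mul_nonneg hu0 (sub_nonneg.2 hu1)) (sub_nonneg.2 hm)
          nlinarith [mul_le_mul_of_nonneg_left h2 hu0, h1, hprod]

/-- **Theorem P (lower bound).**  Every tree with `n` leaves has `B_n(u) ≤ M_t(u)`. -/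
theorem optB_le_treeM {u : ℚ} (hu0 : 0 ≤ u) (hu1 : u ≤ 1) :
    ∀ t : SumTree, optB u (leaves t).length ≤ treeM u t
  | .leaf x => by simp [leaves]
  | .node l r => by
      have ihl := optB_le_treeM hu0 hu1 l
      have ihr := optB_le_treeM hu0 hu1 r
      simp only [leaves, List.length_append, treeM_node]
      rcases le_total (leaves r).length (leaves l).length with h | h
      · have hB := optB_add_le hu0 hu1 _ _ _ le_rfl h
        calc optB u ((leaves l).length + (leaves r).length)
            ≤ optB u (leaves l).length + u * optB u (leaves r).length := hB
          _ ≤ treeM u l + u * treeM u r := by nlinarith [mul_le_mul_of_nonneg_left ihr hu0]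
          _ ≤ max (treeM u l) (treeM u r) + u * min (treeM u l) (treeM u r) :=
              add_mul_le_max_add_mul_min hu1 _ _
      · have hB := optB_add_le hu0 hu1 _ _ _ le_rfl h
        rw [add_comm (leaves l).length]
        calc optB u ((leaves r).length + (leaves l).length)
            ≤ optB u (leaves r).length + u * optB u (leaves l).length := hB
          _ ≤ treeM u r + u * treeM u l := by nlinarith [mul_le_mul_of_nonneg_left ihl hu0]
          _ ≤ max (treeM u r) (treeM u l) + u * min (treeM u r) (treeM u l) :=
              add_mul_le_max_add_mul_min hu1 _ _
          _ = max (treeM u l) (treeM u r) + u * min (treeM u l) (treeM u r) := by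
              rw [max_comm, min_comm]

/-- Every tree has at least one leaf. -/
theorem one_le_length_leaves : ∀ t : SumTree, 1 ≤ (leaves t).length
  | .leaf x => by simp [leaves]
  | .node l r => by
      have := one_le_length_leaves l
      simp only [leaves, List.length_append]; omega

/-- The pairwise (halving) summation tree on `n` leaves (leaf values are irrelevant for `M`). -/
def pw : ℕ → SumTree
  | 0 => .leaf 0
  | 1 => .leaf 0
  | n + 2 => .node (pw ((n + 3) / 2)) (pw ((n + 2) / 2))
decreasing_by all_goals simp_wf; all_goals omega

/-- Defining recursion of `pw (n+2)`. -/
theorem pw_add_two (n : ℕ) : pw (n + 2) = .node (pw ((n + 3) / 2)) (pw ((n + 2) / 2)) := by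
  rw [pw]

/-- `pw n` has `n` leaves (`n ≥ 1`). -/
theorem length_leaves_pw : ∀ n, 1 ≤ n → (leaves (pw n)).length = n := by
  intro n
  induction n using Nat.strong_induction_on with
  | _ n ih =>
    intro hn
    rcases n with _ | _ | n
    · omega
    · simp [pw, leaves]
    · rw [pw_add_two]
      simp only [leaves, List.length_append]
      rw [ih ((n + 3) / 2) (by omega) (by omega), ih ((n + 2) / 2) (by omega) (by omega)]
      omega

/-- **Theorem P (attainment).**  The pairwise tree attains `B_n(u)`. -/
theorem treeM_pw {u : ℚ} (hu0 : 0 ≤ u) : ∀ n, 1 ≤ n → treeM u (pw n) = optB u n := by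
  intro n
  induction n using Nat.strong_induction_on with
  | _ n ih =>
    intro hn
    rcases n with _ | _ | n
    · omega
    · simp [pw]
    · rw [pw_add_two, treeM_node, ih ((n + 3) / 2) (by omega) (by omega),
        ih ((n + 2) / 2) (by omega) (by omega), optB_add_two]
      have hle : optB u ((n + 2) / 2) ≤ optB u ((n + 3) / 2) :=
        optB_mono hu0 (by omega)
      rw [max_eq_left hle, min_eq_right hle]

/-- **Pairwise summation is M-optimal**: for `0 ≤ u ≤ 1` and every tree `t` with `n ≥ 1` leaves,
`M_{pw n}(u) ≤ M_t(u)`; with Theorem U the pairwise tree has the smallest certified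
relative under-estimation constant `1 - 1/B_n(u)` among all summation trees on `n` summands. -/
theorem treeM_pw_le_treeM {u : ℚ} (hu0 : 0 ≤ u) (hu1 : u ≤ 1) (t : SumTree) :
    treeM u (pw (leaves t).length) ≤ treeM u t := by
  have hn : 1 ≤ (leaves t).length := one_le_length_leaves t
  rw [treeM_pw hu0 _ hn]
  exact optB_le_treeM hu0 hu1 t


/-! ## Statement-style R4 proposition (same shape as `LowPrec/OptTreeR4.lean`) -/

/-- R4 (Opt, CM-T Theorem P): for `0 ≤ u ≤ 1` the pairwise (halving) tree minimises the tree polynomial over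
all summation trees with the same number `n` of leaves, and its value is `B_n(u)` (`optB`). -/
def R4_PairwiseMinimisesTreePolynomial : Prop :=
  ∀ u : ℚ, 0 ≤ u → u ≤ 1 →
    (∀ t : SumTree, treeM u (pw (leaves t).length) ≤ treeM u t) ∧
    (∀ n : ℕ, 1 ≤ n → treeM u (pw n) = optB u n ∧ (leaves (pw n)).length = n)

/-- Discharge of `R4_PairwiseMinimisesTreePolynomial` by `treeM_pw_le_treeM`, `treeM_pw`, `length_leaves_pw`. -/
theorem R4_PairwiseMinimisesTreePolynomial_holds : R4_PairwiseMinimisesTreePolynomial :=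
  fun _ hu0 hu1 => ⟨fun t => treeM_pw_le_treeM hu0 hu1 t,
    fun n hn => ⟨treeM_pw hu0 n hn, length_leaves_pw n hn⟩⟩

end Summit.Ventures.CertifiedArithmetic.LowPrec.Opt
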